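import Literature.Computability.Cryptography.FiniteHybrids
import Literature.Computability.Complexity.RunRule
import Literature.Computability.Complexity.OracleLazyTables
import HarnessLib

/-!
# The GGM hybrid argument, I: the round-indexed lazy rule and the lazy/eager sampling principle

Topic `Literature/Computability/Cryptography`; first of the companion files of `GGM.lean`
discharging the named fact `Literature.Computability.Cryptography.GGM1986_thm3` (the Main Theorem
of Goldreich–Goldwasser–Micali 1986: the tree construction over a length-doubling pseudorandom
generator is a pseudorandom function ensemble). This file is the machine-free interface between
the printed proof's lazy sampling (GGM 1986, pp. 800–802, algorithms `A_i`; Goldreich 2001, proof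
of Thm. 3.6.6 with Claim 3.6.6.1) and the tree's toolkits:

* (runs layer, imported) `Complexity/RunRule.lean`: `OracleAlg.runRule M x ans k E` — the run of
  `M` in which the query `u` asked after the transcript `E` is answered by the string `ans E u`
  (a *history-dependent* answer rule), its transcripts `traceR`, the locality principle
  `traceR_congr`, `runRule_historyFree`; the earlier queries are recomputed by
  `LazySampling.lean`'s replay device `OracleAlg.queryAt` (`keyAtRound`, `firstIdx` — the keyed
  form of `cachedAnswer`);
* (sampling principle, imported) `Complexity/OracleLazyTables.lean` (the SURVIVOR formalisation of
  Goldreich's Claim 3.6.6.1 in the tree): `TableSpec K V`, the eager oracle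
  `TableSpec.tableOracle` of a table sampled up front, the lazy run `TableSpec.lazyAux` with an
  association list and a supply consumed one value per query round, and
  `TableSpec.prob_run_tableOracle_eq` (uniform table versus uniform supply give the same output
  law). Nothing of it is re-proved here;
* NEW: the **round-indexed lazy rule** `GGMHyb.lazyRule M x key post pool : Rule` — the SAME lazy
  process presented as a history-dependent answer rule, which is the interface the simulator of
  `GGMSimulator.lean` implements (a stateless `FP` oracle recomputing, from the transcript, the
  first earlier ROUND whose query had the same key — Goldreich's convention "in case the path of the
  `i`th query requires a new string, we use the `i`th input string (rather than the first input
  string not used thus far)", 2001, p. 189): a query `u` with key `κ` after transcript `E` is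
  answered `post v u` with `v = pool m*`, `m*` the first earlier round asking `κ`, or the current
  round `|E|`; `GGMHyb.eagerOracle key post := (toSpec key post).tableOracle`;
* NEW, PROVED: the **bridge** `runRule_lazyRule_eq_lazyAux` — the rule-run of `lazyRule` on the
  pool `pool : Fin t → V` IS the lazy run `TableSpec.lazyAux` on the supply `List.ofFn pool`
  (induction on rounds; invariant: the association list is the table of first rounds found by
  `firstIdx` along the transcript, `assocFind κ tbl = (firstIdx … κ).map pool`), whence
  **`uProb_lazy_eq_eager`** — the counting probability (`uProb`, `FiniteHybrids.lean`) over
  uniform pools that the rule-run outputs `b` equals that over uniform tables that the eager run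
  does — as a corollary of `prob_run_tableOracle_eq`.

The GGM-specific hybrids (keys = level-`i` prefixes, values = labels) are in
`GGMHybridGames.lean`; the simulator machine in `GGMSimulator.lean`; the assembly in
`GGMProofs.lean`.

## References

* O. Goldreich, S. Goldwasser, S. Micali, *How to construct random functions*, J. ACM 33 (1986)
  792–807, §3.3, Thm. 3 and its proof (algorithms `A_i`, the test `A_T`), pp. 800–802.
* O. Goldreich, *Foundations of Cryptography I: Basic Tools*, CUP 2001, §3.6.2, Thm. 3.6.6 and
  its proof, Claim 3.6.6.1 (pp. 187–192 of the 2004 printing).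
-/

namespace Literature.Computability.Cryptography

open _root_.Computability Complexity Complexity.OracleAlg

namespace GGMHyb

variable {β : Type}



/-! ### The key asked at an earlier round (replaying the step function, `OracleAlg.queryAt`) -/

section Replay

variable (M : OracleAlg β) (x : List Bool) {K : Type} (key : List Bool → Option K)

/-- The key of the query asked at round `k` along `E` (`none`: no query, or an invalid one); the
query itself is `LazySampling.lean`'s replay `OracleAlg.queryAt` (the step function on the first
`k` answers). [Goldreich 2001, p. 189 ("algorithm D records this query")] [folklore] -/
def keyAtRound (E : List (List Bool)) (k : ℕ) : Option K :=
  (queryAt M x E k).bind key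

/-- `keyAtRound` only reads the first `k` answers. [folklore] -/
theorem keyAtRound_of_prefix {E E' : List (List Bool)} (h : E <+: E') {k : ℕ} (hk : k ≤ E.length) :
    keyAtRound M x key E' k = keyAtRound M x key E k := by
  unfold keyAtRound
  rw [queryAt_of_prefix M x h hk]

variable [DecidableEq K]

/-- The first round before `|E|` whose query has key `κ`, if any. [Goldreich 2001, p. 189 ("let `j`
be the smallest integer such that the `k`-bit prefix of the `i`th query equals the `k`-bit prefix
of the `j`th query")] [folklore] -/
def firstIdx (E : List (List Bool)) (κ : K) : Option ℕ :=
  (List.range E.length).find? fun k => decide (keyAtRound M x key E k = some κ)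

/-- What `firstIdx` finds. [folklore] -/
theorem firstIdx_eq_some_iff {E : List (List Bool)} {κ : K} {k : ℕ} :
    firstIdx M x key E κ = some k ↔
      k < E.length ∧ keyAtRound M x key E k = some κ ∧ ∀ k' < k, keyAtRound M x key E k' ≠ some κ := by
  rw [firstIdx, List.find?_range_eq_some]
  simp only [decide_eq_true_eq, List.mem_range, Bool.not_eq_true', decide_eq_false_iff_not]
  tauto

/-- When `firstIdx` finds nothing. [folklore] -/
theorem firstIdx_eq_none_iff {E : List (List Bool)} {κ : K} :
    firstIdx M x key E κ = none ↔ ∀ k < E.length, keyAtRound M x key E k ≠ some κ := by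
  rw [firstIdx, List.find?_eq_none]
  simp only [List.mem_range, decide_eq_true_eq]

/-- A found index is in range. [folklore] -/
theorem lt_length_of_firstIdx_eq_some {E : List (List Bool)} {κ : K} {k : ℕ}
    (h : firstIdx M x key E κ = some k) : k < E.length :=
  ((firstIdx_eq_some_iff M x key).1 h).1

/-- `firstIdx` along a prefix: an index found in the prefix is found in the whole. [folklore] -/
theorem firstIdx_of_prefix_of_eq_some {E E' : List (List Bool)} (h : E <+: E') {κ : K} {k : ℕ}
    (hk : firstIdx M x key E κ = some k) : firstIdx M x key E' κ = some k := by
  obtain ⟨h1, h2, h3⟩ := (firstIdx_eq_some_iff M x key).1 hk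
  refine (firstIdx_eq_some_iff M x key).2 ⟨lt_of_lt_of_le h1 h.length_le, ?_, fun k' hk' => ?_⟩
  · rwa [keyAtRound_of_prefix M x key h h1.le]
  · rw [keyAtRound_of_prefix M x key h (hk'.le.trans h1.le)]
    exact h3 k' hk'

/-- `firstIdx` along a prefix: if nothing is found in the prefix `E` and round `|E|` of the
extension asks key `κ`, then `|E|` is the first index in the extension. [folklore] -/
theorem firstIdx_of_prefix_of_eq_none {E E' : List (List Bool)} (h : E <+: E') (hlt : E.length < E'.length)
    {κ : K} (hk : firstIdx M x key E κ = none) (hnow : keyAtRound M x key E' E.length = some κ) :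
    firstIdx M x key E' κ = some E.length := by
  rw [firstIdx_eq_none_iff] at hk
  refine (firstIdx_eq_some_iff M x key).2 ⟨hlt, hnow, fun k' hk' => ?_⟩
  rw [keyAtRound_of_prefix M x key h hk'.le]
  exact hk k' hk'

end Replay

/-! ### The round-indexed lazy rule and the eager oracle -/

section LazyEager

variable (M : OracleAlg β) (x : List Bool) {K V : Type} (key : List Bool → Option K)
  (post : V → List Bool → List Bool)

/-- The table specification (`OracleLazyTables.lean`) of a key reader `key` and an answer function
`post` (value first); keyless queries are answered `ε`. [Goldreich 2001, proof of Thm. 3.6.6] [folklore] -/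
def toSpec : TableSpec K V := ⟨key, fun u v => post v u, fun _ => []⟩

/-- **The eager oracle** of a table `T : K → V`: a query with key `κ` is answered `post (T κ) u`,
an invalid one by `ε` — `TableSpec.tableOracle` of `toSpec` (the hybrid `H_n^k = f_{U⁽¹⁾,…,U⁽²ᵏ⁾}`
of Goldreich 2001, p. 187, is the case keys = `k`-bit prefixes, values = labels).
[Goldreich 2001, proof of Thm. 3.6.6 (p. 187)] [folklore] -/
def eagerOracle (T : K → V) : Oracle := (toSpec key post).tableOracle T

/-- The eager oracle, by cases on the key. [folklore] -/
theorem eagerOracle_apply (T : K → V) (u : List Bool) :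
    eagerOracle key post T u = (match key u with
      | none => []
      | some κ => post (T κ) u) := by
  cases h : key u <;> simp [eagerOracle, TableSpec.tableOracle, toSpec, h]

/-- The key of the round just answered is the key of its query. [folklore] -/
theorem keyAtRound_append_singleton_length {E : List (List Bool)} (a : List Bool) {u : List Bool}
    (hs : M.step x E = Sum.inl u) : keyAtRound M x key (E ++ [a]) E.length = key u := by
  unfold keyAtRound queryAt
  rw [List.take_left' rfl, hs]
  rfl

variable [DecidableEq K]

/-- **The round-indexed lazy rule** with value pool `pool : ℕ → V`: a query `u` with key `κ` after
transcript `E` is answered `post v u` with `v = pool m*`, `m*` the first earlier round whose query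
had key `κ`, or the current round `|E|` if there is none; invalid queries get `ε`.
[Goldreich 2001, p. 189 (algorithm `D`: "we associate this prefix with a new input string, the
`i`th one"); GGM 1986, p. 801 (`A_T` "picks the next string in `U_k`")] [cite: GGM1986, p. 801] -/
def lazyRule (pool : ℕ → V) : Rule := fun E u =>
  match key u with
  | none => []
  | some κ => post (pool ((firstIdx M x key E κ).getD E.length)) u

/-- Extension of a finite pool by a default value past the round budget. [folklore] -/
def ext [Inhabited V] (t : ℕ) (pool : Fin t → V) (m : ℕ) : V :=
  if h : m < t then pool ⟨m, h⟩ else default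

/-- `ext` on an index within the budget. [folklore] -/
theorem ext_of_lt [Inhabited V] {t : ℕ} (pool : Fin t → V) {m : ℕ} (h : m < t) :
    ext t pool m = pool ⟨m, h⟩ := dif_pos h

/-- A new round whose key is not `κ` does not change where `κ` is first found. [folklore] -/
theorem firstIdx_append_singleton_of_ne {E : List (List Bool)} (a : List Bool) {κ : K}
    (h : keyAtRound M x key (E ++ [a]) E.length ≠ some κ) :
    firstIdx M x key (E ++ [a]) κ = firstIdx M x key E κ := by
  cases hf : firstIdx M x key E κ with
  | some m => exact firstIdx_of_prefix_of_eq_some M x key (List.prefix_append E [a]) hf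
  | none =>
    rw [firstIdx_eq_none_iff] at hf ⊢
    intro k hk
    rw [List.length_append, List.length_singleton] at hk
    rcases Nat.lt_succ_iff_lt_or_eq.1 hk with hk | rfl
    · rw [keyAtRound_of_prefix M x key (List.prefix_append E [a]) hk.le]; exact hf k hk
    · exact h

variable [Inhabited V] (t : ℕ)

/-- The supply past round `m` of a pool of `t` values. [folklore] -/
theorem headI_drop_ofFn (pool : Fin t → V) {m : ℕ} (h : m < t) : ((List.ofFn pool).drop m).headI = pool ⟨m, h⟩ := by
  have hm : m < (List.ofFn pool).length := by simpa using h
  rw [List.drop_eq_getElem_cons hm, List.headI_cons, List.getElem_ofFn]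

/-- **The bridge, from an arbitrary state**: the rule-run of `lazyRule` from a transcript `E` all
of whose rounds queried, with `k` rounds left (`|E| + k = t`), is the lazy run `TableSpec.lazyAux`
from `E` with the association list of first rounds found so far (`assocFind κ tbl =
(firstIdx … κ).map pool`) and the supply past round `|E|`. [Goldreich 2001, proof of
Claim 3.6.6.1] [folklore] -/
theorem runRule_lazyRule_eq_lazyAux_aux (pool : Fin t → V) :
    ∀ (k : ℕ) (E : List (List Bool)) (tbl : List (K × V)), E.length + k = t →
      (∀ m < E.length, ∃ q, queryAt M x E m = some q) →
      (∀ κ, LazyTable.assocFind κ tbl = (firstIdx M x key E κ).map (ext t pool)) →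
      runRule M x (lazyRule M x key post (ext t pool)) k E =
        (toSpec key post).lazyAux M x k E tbl ((List.ofFn pool).drop E.length)
  | 0, _, _, _, _, _ => by rw [runRule_zero, TableSpec.lazyAux_zero]
  | k + 1, E, tbl, hlen, hq, htbl => by
    rw [runRule_succ, TableSpec.lazyAux_succ]
    cases hs : M.step x E with
    | inr b => rfl
    | inl u =>
      have hlt : E.length < t := by omega
      have hq' : ∀ a : List Bool, ∀ m < (E ++ [a]).length, ∃ q, queryAt M x (E ++ [a]) m = some q := by
        intro a m hm
        rw [List.length_append, List.length_singleton] at hm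
        rcases Nat.lt_succ_iff_lt_or_eq.1 hm with hm | rfl
        · obtain ⟨q, hq''⟩ := hq m hm
          exact ⟨q, by rw [queryAt_of_prefix M x (List.prefix_append E [a]) hm.le, hq'']⟩
        · exact ⟨u, queryAt_length_of_inl M x hs ▸ by rw [queryAt_of_prefix M x (List.prefix_append E [a]) le_rfl]⟩
      have hdrop : ∀ a : List Bool, ((List.ofFn pool).drop E.length).tail = (List.ofFn pool).drop (E ++ [a]).length := by
        intro a; rw [List.tail_drop, List.length_append, List.length_singleton]
      show runRule M x (lazyRule M x key post (ext t pool)) k (E ++ [lazyRule M x key post (ext t pool) E u]) =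
        (match (toSpec key post).key u with
          | none => (toSpec key post).lazyAux M x k (E ++ [(toSpec key post).ans₀ u]) tbl ((List.ofFn pool).drop E.length).tail
          | some κ =>
            match LazyTable.assocFind κ tbl with
            | some w => (toSpec key post).lazyAux M x k (E ++ [(toSpec key post).ans u w]) tbl ((List.ofFn pool).drop E.length).tail
            | none => (toSpec key post).lazyAux M x k (E ++ [(toSpec key post).ans u ((List.ofFn pool).drop E.length).headI])
                (tbl ++ [(κ, ((List.ofFn pool).drop E.length).headI)]) ((List.ofFn pool).drop E.length).tail)
      have hkey : (toSpec key post).key u = key u := rfl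
      have hans : ∀ w, (toSpec key post).ans u w = post w u := fun _ => rfl
      have hans₀ : (toSpec key post).ans₀ u = [] := rfl
      simp only [hkey, hans, hans₀]
      unfold lazyRule
      cases hκ : key u with
      | none =>
        simp only
        rw [hdrop []]
        refine runRule_lazyRule_eq_lazyAux_aux pool k _ tbl (by simp; omega) (hq' _) fun κ => ?_
        rw [htbl κ, firstIdx_append_singleton_of_ne M x key _
          (by rw [keyAtRound_append_singleton_length M x key _ hs, hκ]; simp)]
      | some κ₀ =>
        simp only
        rw [htbl κ₀]
        cases hf : firstIdx M x key E κ₀ with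
        | some m₀ =>
          simp only [Option.map_some, Option.getD_some]
          rw [hdrop (post (ext t pool m₀) u)]
          refine runRule_lazyRule_eq_lazyAux_aux pool k _ tbl (by simp; omega) (hq' _) fun κ => ?_
          rw [htbl κ]
          by_cases hκκ : κ = κ₀
          · subst hκκ
            rw [hf, firstIdx_of_prefix_of_eq_some M x key (List.prefix_append E _) hf]
          · rw [firstIdx_append_singleton_of_ne M x key _
              (by rw [keyAtRound_append_singleton_length M x key _ hs, hκ]; simpa using fun h => hκκ h.symm)]
        | none =>
          simp only [Option.map_none, Option.getD_none]
          rw [headI_drop_ofFn t pool hlt, ← ext_of_lt pool hlt, hdrop (post (ext t pool E.length) u)]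
          refine runRule_lazyRule_eq_lazyAux_aux pool k _ _ (by simp; omega) (hq' _) fun κ => ?_
          rw [LazyTable.assocFind_append_singleton, htbl κ]
          by_cases hκκ : κ₀ = κ
          · subst hκκ
            rw [hf]
            simp only [Option.map_none, if_true]
            rw [firstIdx_of_prefix_of_eq_none M x key (List.prefix_append E _) (by simp) hf
              (by rw [keyAtRound_append_singleton_length M x key _ hs, hκ])]
            rfl
          · rw [firstIdx_append_singleton_of_ne M x key _
              (by rw [keyAtRound_append_singleton_length M x key _ hs, hκ]; simpa using hκκ)]
            cases firstIdx M x key E κ with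
            | some m => rfl
            | none => simp [hκκ]

/-- **The bridge**: the rule-run of the round-indexed lazy rule on a pool of `t` values within
`t` rounds is the lazy run `TableSpec.lazyAux` of `OracleLazyTables.lean` on the supply of those
values. [Goldreich 2001, proof of Claim 3.6.6.1] [folklore] -/
theorem runRule_lazyRule_eq_lazyAux (pool : Fin t → V) :
    runRule M x (lazyRule M x key post (ext t pool)) t [] = (toSpec key post).lazyAux M x t [] [] (List.ofFn pool) := by
  have h := runRule_lazyRule_eq_lazyAux_aux M x key post t pool t [] [] (by simp) (by simp) (fun κ => by
    rw [LazyTable.assocFind_nil, (firstIdx_eq_none_iff M x key).2 (by simp)]; rfl)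
  simpa using h

/-- **The lazy/eager sampling principle** for the rule-run (Goldreich 2001, Claim 3.6.6.1; GGM 1986,
p. 801 "`A_T` simulates a computation of `T` with oracle `A_i`"): the probability over a uniform
pool `pool : Fin t → V` that the rule-run of `lazyRule` within `t` rounds outputs `b` equals the
probability over a uniform table `T : K → V` that the eager run does — a corollary of
`TableSpec.prob_run_tableOracle_eq` through the bridge. [Goldreich 2001, Claim 3.6.6.1
(pp. 189–192)] [cite: Goldreich2001, Claim 3.6.6.1] -/
theorem uProb_lazy_eq_eager [Fintype K] [Fintype V] [DecidableEq V] [DecidableEq β] (b : β) :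
    uProb (fun pool : Fin t → V => decide (runRule M x (lazyRule M x key post (ext t pool)) t [] = some b)) =
      uProb (fun T : K → V => decide (M.runAux (eagerOracle key post T) x t [] = some b)) := by
  classical
  have h := (toSpec key post).prob_run_tableOracle_eq M x t b
  have e1 : (Finset.univ.filter fun pool : Fin t → V =>
      decide (runRule M x (lazyRule M x key post (ext t pool)) t [] = some b) = true) =
      Finset.univ.filter fun s : Fin t → V => (toSpec key post).lazyAux M x t [] [] (List.ofFn s) = some b := by
    ext s; simp [runRule_lazyRule_eq_lazyAux]
  have e2 : (Finset.univ.filter fun T : K → V => decide (M.runAux (eagerOracle key post T) x t [] = some b) = true) =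
      Finset.univ.filter fun T : K → V => M.run ((toSpec key post).tableOracle T) t x = some b := by
    ext T; simp [eagerOracle, OracleAlg.run]
  unfold uProb
  rw [e1, e2]
  exact h.symm

end LazyEager

end GGMHyb

end Literature.Computability.Cryptography
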